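import Literature.AnabelianGeometry.EtaleTheta.Discharge.Sec2TowerRowsAtModelTateOfExtendsModFour
import HarnessLib

/-!
# [EtTh] §2 tower / rigidity rows AT THE TATE DATUM OF RECORD — the (HGAL)-free, PARITY-EXPLICIT form of the
# Cor. 2.18 (i) binder, valid at EVERY `p` (row «COR218I-PARITY-RESIDUAL@TATE»; proof-only one-term knits over
# abc-iut-L6-d6's parity lemmas; FROZEN FACT-LIST rows F-0620, F-0649, F-0647, F-0625, F-0639 at `etaleThetaDataχqInr p`)

S. Mochizuki, *The étale theta function and its Frobenioid-theoretic manifestations*, Publ. RIMS **45** (2009)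
[EtTh], §1 Thm. 1.6 (i) p. 24, §2: Cor. 2.18 (i) p. 60, Cor. 2.18 (iv) pp. 61–62, Cor. 2.19 (ii) p. 64 (locators
`p.N` = PDF pages of the PRIMS text) [cite: MochizukiEtTh2009, Cor 2.18 (i) p.60].  Cell `abc-iut`, block F, seat
abc-iut-f-148 (gen 7); row «COR218I-PARITY-RESIDUAL@TATE» (abc-iut-L2-lead gen 7, ROWS #131 R1004, 2026-08-27).
PROOF-ONLY: no definition, no instance, no notation, no new named fact; every input consumed BY NAME —
abc-iut-L6-d6's `map_GtpYdd_le_of_levelHom_two_y_eq_zero`, `levelHom_two_y_symm_eq_zero`, `map_deltaTempχq_symm_eq`,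
`map_GtpYdd_eq_iff_levelHom_two_y_eq_zero` (`Sec2Cor218iAtModelTateNonInner(ModFour)`, p476780 / p477049),
abc-iut-L2-d1's `rigidData_cor218_i_of_extends` (`Sec2Cor218iThetaSubquotients`), abc-iut-f-153's `…_of_rigidity` rows
(p453594 / p454435 / p456036 / p457392); nothing restated.

THE BINDER.  At the stage-2 model `Π^tp_X := PiTpχq p i 2` (every prime `p`, every `i`) write, for a topological
automorphism `Γ` stabilising `Δ^tp_X`, `par(Γ) := y(ĥ₂((Γ(inl a)).left)) ∈ ℤ/2` — the parity of the `b`-exponent of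
`Γ(a)` (`a = gfpOf (FreeGroup.of 0)`).  abc-iut-L6-d6 proved (c, ⇐) «`par(Γ) = 0 ⇒ Γ(Π^tp_Ÿ) ⊆ Π^tp_Ÿ`» for EVERY `p`,
`i`, and the converse for `p ≢ 1 (mod 4)`, `i` odd.  The (HGAL)-free binder valid at every `p` is therefore
  `hextPar` : every bi-continuous automorphism `γ` of `Π^tp_{X̲̲} = C.Huu` extends to a bi-continuous automorphism `Γ` of
              `Π^tp_X` with `Γ(Δ^tp_X) = Δ^tp_X` AND `par(Γ) = 0`.

WHAT THIS FILE DOES (one-term compositions):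
* §1 `map_GtpYdd_eq_of_map_deltaTemp_eq_of_levelHom_two_y_eq_zero` — EVERY `p`, `i`: `Δ^tp_X`-stable `Γ` with
  `par(Γ) = 0` satisfies `Γ(Π^tp_Ÿ) = Π^tp_Ÿ` (EQUALITY: L6-d6's inclusion for `Γ` and for `Γ⁻¹`);
  `exists_extends_three_of_parity` — `hextPar ⇒ hext` (abc-iut-f-153's three-clause binder: extension ∧ `Δ^tp_X` ∧
  `Π^tp_Ÿ` stability), every `p`, `i`; `exists_extends_three_iff_parity` — for `p ≢ 1 (mod 4)`, `i` odd the two binders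
  are EQUIVALENT (the residual of record IS the parity condition, nothing weaker);
* §2 `rigidData_cor218_i_modelχq_of_extends_of_parity` — F-0620 `Cor218_i` at `modelχq p i 2` for every étale-theta
  datum `E`, every `X̲̲`-choice, every level, the EMPTY labelling, FROM `hextPar` (every `p`, `i`);
* §3 the datum of record (`i = 1`, `E := etaleThetaDataχqInr p`): `cor218_i_levels_emptyLabels_modelTate_inr_of_extends_of_parity`
  (every chain level) / `cor218_i_modAll_…_of_parity`, and the rows `cor219_ii_modelTate_inr_of_extends_of_parity` (F-0649),
  `cor218_iv_bijective_of_odd_modelTate_inr_of_extends_of_parity` (F-0647),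
  `rigidData_cor218_iv_surjective_modAll_modelTate_inr_of_extends_of_parity` (F-0625),
  `thetaEnvData_cor218_iv_surjective_modAll_modelTate_inr_of_extends_of_parity` (F-0639),
  `sec2_tower_rows_modelTate_inr_of_extends_of_parity` (census conjunction) — all ⟸ {`hextPar`, `h219iii`}, EVERY `p`.

RESIDUAL-OF-RECORD after this file, every `p`: {`hextPar`, `h219iii`}; for `p ≡ 1 (mod 4)` (`χ₄ ≡ 1`) `hextPar` weakens to
`hextΔ` (`Sec2TowerRowsAtModelTateOfExtendsModFour`, p490418: the parity clause is then automatic); for `p ≢ 1 (mod 4)`,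
`i` odd, `hextPar` is EQUIVALENT to abc-iut-f-153's three-clause `hext` (§1) — whether a `Δ^tp_X`-stabilising `Γ` of ODD
parity exists there is a statement about `Aut_top(G_{ℚ_p})` (abc-iut-L6-d6 gen-5/6 memos), not decided in the tree.
HONEST LABEL: `modelχq` is a SEMI-SYNTHETIC model of the typed §1 interface — binder-discharge / consistency evidence for
OUR typed rows only; nothing of [EtTh] (refereed) is asserted; a FACT row is an assumption label, not an endorsement; no
side is taken on [IUTchIII] Cor. 3.12; typed ≠ proved.
-/

noncomputable section

namespace Literature.AnabelianGeometry.EtaleTheta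

namespace SettingModel

open Literature.AnabelianGeometry.SemiGraphs Function Topology

variable (p : ℕ) [Fact p.Prime] (i : ℤ)

/-! ## §1. Parity ⇒ `Π^tp_Ÿ`-stability (every `p`, every `i`); the three-clause binder from the parity binder -/

/-- **EVERY `p`, EVERY `i`: a `Δ^tp_X`-stabilising topological automorphism `Γ` of `Π^tp_X(modelχq p i 2)` whose
`b`-exponent of `Γ(a)` is EVEN satisfies `Γ(Π^tp_Ÿ) = Π^tp_Ÿ`** (equality) — abc-iut-L6-d6's inclusion
`map_GtpYdd_le_of_levelHom_two_y_eq_zero` for `Γ` and for `Γ⁻¹` (`levelHom_two_y_symm_eq_zero`, `map_deltaTempχq_symm_eq`);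
this is the `⇐` half of `map_GtpYdd_eq_iff_levelHom_two_y_eq_zero` WITHOUT its `p ≢ 1 (mod 4)` / `i` odd side conditions
(which only the `⇒` half uses). [cite: MochizukiEtTh2009, Thm 1.6 (i) p.24] -/
theorem map_GtpYdd_eq_of_map_deltaTemp_eq_of_levelHom_two_y_eq_zero (Γ : PiTpχq p i 2 ≃ₜ* PiTpχq p i 2)
    (hΔ : (curveχq p i 2).DeltaTemp.map Γ.toMulEquiv.toMonoidHom = (curveχq p i 2).DeltaTemp)
    (hpar : (levelHom 2 (Γ (SemidirectProduct.inl (gfpOf (FreeGroup.of 0)))).left).y = 0) :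
    (ThetaSetting.modelχq p i 2 even_two).GtpYdd.map Γ.toMulEquiv.toMonoidHom =
      (ThetaSetting.modelχq p i 2 even_two).GtpYdd := by
  refine le_antisymm (map_GtpYdd_le_of_levelHom_two_y_eq_zero p i Γ hΔ hpar) fun g hg => ?_
  exact ⟨Γ.symm g, map_GtpYdd_le_of_levelHom_two_y_eq_zero p i Γ.symm (map_deltaTempχq_symm_eq p i Γ hΔ)
    (levelHom_two_y_symm_eq_zero p i Γ hΔ hpar) ⟨g, hg, rfl⟩, Γ.apply_symm_apply g⟩

/-- **`hextPar ⇒ hext`** (every `p`, `i`): the parity-explicit extension binder yields abc-iut-f-153's three-clause binder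
«every `γ ∈ Aut_top(Π^tp_{X̲̲})` extends to a `Γ` stabilising `Δ^tp_X` AND `Π^tp_Ÿ`». [cite: MochizukiEtTh2009, Cor 2.18 (i) p.60] -/
theorem exists_extends_three_of_parity {H : Subgroup (PiTpχq p i 2)}
    (hextPar : ∀ γ : ↥H ≃ₜ* ↥H, ∃ Γ : PiTpχq p i 2 ≃ₜ* PiTpχq p i 2,
      (∀ h : H, Γ (h : PiTpχq p i 2) = ((γ h : H) : PiTpχq p i 2)) ∧
        (curveχq p i 2).DeltaTemp.map Γ.toMulEquiv.toMonoidHom = (curveχq p i 2).DeltaTemp ∧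
        (levelHom 2 (Γ (SemidirectProduct.inl (gfpOf (FreeGroup.of 0)))).left).y = 0)
    (γ : ↥H ≃ₜ* ↥H) :
    ∃ Γ : PiTpχq p i 2 ≃ₜ* PiTpχq p i 2,
      (∀ h : H, Γ (h : PiTpχq p i 2) = ((γ h : H) : PiTpχq p i 2)) ∧
        (curveχq p i 2).DeltaTemp.map Γ.toMulEquiv.toMonoidHom = (curveχq p i 2).DeltaTemp ∧
        (ThetaSetting.modelχq p i 2 even_two).GtpYdd.map Γ.toMulEquiv.toMonoidHom =
          (ThetaSetting.modelχq p i 2 even_two).GtpYdd := by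
  obtain ⟨Γ, hΓ, hΔ, hpar⟩ := hextPar γ
  exact ⟨Γ, hΓ, hΔ, map_GtpYdd_eq_of_map_deltaTemp_eq_of_levelHom_two_y_eq_zero p i Γ hΔ hpar⟩

/-- **THE RESIDUAL OF RECORD at `p ≢ 1 (mod 4)`, `i` odd, binder level: `hext ⟺ hextPar`.**  For a subgroup `H ≤ Π^tp_X`
(e.g. `Π^tp_{X̲̲} = C.Huu`), «every `γ ∈ Aut_top(H)` extends to a `Γ` stabilising `Δ^tp_X` and `Π^tp_Ÿ`» holds iff «every `γ`
extends to a `Γ` stabilising `Δ^tp_X` with EVEN `b`-exponent of `Γ(a)`» — per `Γ` this is abc-iut-L6-d6's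
`map_GtpYdd_eq_iff_levelHom_two_y_eq_zero`. [cite: MochizukiEtTh2009, Thm 1.6 (i) p.24] -/
theorem exists_extends_three_iff_parity (hi : Odd i) (hp : p % 4 ≠ 1) {H : Subgroup (PiTpχq p i 2)} :
    (∀ γ : ↥H ≃ₜ* ↥H, ∃ Γ : PiTpχq p i 2 ≃ₜ* PiTpχq p i 2,
      (∀ h : H, Γ (h : PiTpχq p i 2) = ((γ h : H) : PiTpχq p i 2)) ∧
        (curveχq p i 2).DeltaTemp.map Γ.toMulEquiv.toMonoidHom = (curveχq p i 2).DeltaTemp ∧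
        (ThetaSetting.modelχq p i 2 even_two).GtpYdd.map Γ.toMulEquiv.toMonoidHom =
          (ThetaSetting.modelχq p i 2 even_two).GtpYdd) ↔
    (∀ γ : ↥H ≃ₜ* ↥H, ∃ Γ : PiTpχq p i 2 ≃ₜ* PiTpχq p i 2,
      (∀ h : H, Γ (h : PiTpχq p i 2) = ((γ h : H) : PiTpχq p i 2)) ∧
        (curveχq p i 2).DeltaTemp.map Γ.toMulEquiv.toMonoidHom = (curveχq p i 2).DeltaTemp ∧
        (levelHom 2 (Γ (SemidirectProduct.inl (gfpOf (FreeGroup.of 0)))).left).y = 0) := by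
  refine ⟨fun h γ => ?_, fun h γ => exists_extends_three_of_parity p i h γ⟩
  obtain ⟨Γ, hΓ, hΔ, hY⟩ := h γ
  exact ⟨Γ, hΓ, hΔ, (map_GtpYdd_eq_iff_levelHom_two_y_eq_zero p i hi hp Γ hΔ).mp hY⟩

/-! ## §2. F-0620 `Cor218_i` at `modelχq p i 2` from the parity binder (every `p`, every `i`; empty labelling) -/

/-- **F-0620 `Cor218_i` at `modelχq p i 2`, for every étale-theta datum `E`, every `X̲̲`-choice `C`, every level `μ`, `hC`,
`hS`, `h15` and the EMPTY cusp labelling, FROM `hextPar`, at EVERY `p` and EVERY `i`** (abc-iut-L2-d1's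
`rigidData_cor218_i_of_extends` with the `Π^tp_Ÿ`-clause supplied by §1). CONDITIONAL-AT-MODEL: `hextPar` is displayed,
not asserted. [cite: MochizukiEtTh2009, Cor 2.18 (i) p.60] -/
theorem rigidData_cor218_i_modelχq_of_extends_of_parity
    {E : (ThetaSetting.modelχq p i 2 even_two).EtaleThetaData} {l : ℕ} (C : E.DoubleUnderline l) {N : ℕ+}
    (μ : (ThetaSetting.modelχq p i 2 even_two).CyclotomeMod l N) (hC : (ThetaSetting.modelχq p i 2 even_two).Compat)
    (hS : (ThetaSetting.modelχq p i 2 even_two).Sec2Hyps) (h15 : ThetaSetting.Prop15iii E hC)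
    (hextPar : ∀ γ : ↥C.Huu ≃ₜ* ↥C.Huu, ∃ Γ : PiTpχq p i 2 ≃ₜ* PiTpχq p i 2,
      (∀ h : C.Huu, Γ (h : PiTpχq p i 2) = ((γ h : C.Huu) : PiTpχq p i 2)) ∧
        (curveχq p i 2).DeltaTemp.map Γ.toMulEquiv.toMonoidHom = (curveχq p i 2).DeltaTemp ∧
        (levelHom 2 (Γ (SemidirectProduct.inl (gfpOf (FreeGroup.of 0)))).left).y = 0) :
    (C.rigidData μ hC hS h15 ⟨fun _ => ∅, fun _ => ∅, fun _ => rfl⟩).Cor218_i :=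
  C.rigidData_cor218_i_of_extends μ hC hS h15 _ (exists_extends_three_of_parity p i hextPar)
    (fun _ _ => Set.image_empty _)

end SettingModel

/-! ## §3. The datum of record `(i, j) = (1, 2)`, `E := etaleThetaDataχqInr p`: the tower rows from {hextPar, h219iii} -/

namespace SettingModel

open Literature.AnabelianGeometry.SemiGraphs

variable (p : ℕ) [Fact p.Prime]
variable {l : ℕ} (C : (etaleThetaDataχqInr p).DoubleUnderline l) {Es : Set ℕ+}
  (τ : (ThetaSetting.modelχq p 1 2 even_two).CyclotomeTower l Es)

/-- **F-0620 [EtTh] Cor. 2.18 (i) at EVERY chain level of the model tower of the datum OF RECORD, empty labelling, FROM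
`hextPar`, every `p`** (§2 at `i := 1`, `μ := τ.mod M`, `h15 :=` abc-iut-w5-d171's `prop15iii_etaleThetaDataχqInr`) — the
binder `h218i` of abc-iut-f-153's `…_of_rigidity` rows. [cite: MochizukiEtTh2009, Cor 2.18 (i) p.60] -/
theorem cor218_i_levels_emptyLabels_modelTate_inr_of_extends_of_parity
    (hextPar : ∀ γ : ↥C.Huu ≃ₜ* ↥C.Huu, ∃ Γ : PiTpχq p 1 2 ≃ₜ* PiTpχq p 1 2,
      (∀ h : C.Huu, Γ (h : PiTpχq p 1 2) = ((γ h : C.Huu) : PiTpχq p 1 2)) ∧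
        (curveχq p 1 2).DeltaTemp.map Γ.toMulEquiv.toMonoidHom = (curveχq p 1 2).DeltaTemp ∧
        (levelHom 2 (Γ (SemidirectProduct.inl (gfpOf (FreeGroup.of 0)))).left).y = 0)
    (M : Es) :
    (C.rigidData (τ.mod M) (compat_modelχq p 1 2 even_two) (ThetaSetting.modelχq_sec2Hyps p 1 2 even_two)
      (prop15iii_etaleThetaDataχqInr p _) ⟨fun _ => ∅, fun _ => ∅, fun _ => rfl⟩).Cor218_i :=
  rigidData_cor218_i_modelχq_of_extends_of_parity p 1 C (τ.mod M) _ _ _ hextPar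

/-- The same at the levels `τ.modAll M`, `M ∈ ℕ≥1`, every `p`. [cite: MochizukiEtTh2009, Cor 2.18 (i) p.60] -/
theorem cor218_i_modAll_emptyLabels_modelTate_inr_of_extends_of_parity
    (hextPar : ∀ γ : ↥C.Huu ≃ₜ* ↥C.Huu, ∃ Γ : PiTpχq p 1 2 ≃ₜ* PiTpχq p 1 2,
      (∀ h : C.Huu, Γ (h : PiTpχq p 1 2) = ((γ h : C.Huu) : PiTpχq p 1 2)) ∧
        (curveχq p 1 2).DeltaTemp.map Γ.toMulEquiv.toMonoidHom = (curveχq p 1 2).DeltaTemp ∧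
        (levelHom 2 (Γ (SemidirectProduct.inl (gfpOf (FreeGroup.of 0)))).left).y = 0)
    (M : ℕ+) :
    (C.rigidData (τ.modAll M) (compat_modelχq p 1 2 even_two) (ThetaSetting.modelχq_sec2Hyps p 1 2 even_two)
      (prop15iii_etaleThetaDataχqInr p _) ⟨fun _ => ∅, fun _ => ∅, fun _ => rfl⟩).Cor218_i :=
  rigidData_cor218_i_modelχq_of_extends_of_parity p 1 C (τ.modAll M) _ _ _ hextPar

/-- **F-0649 [EtTh] Cor. 2.19 (ii) for the model tower of the datum OF RECORD, modulo {`hextPar`, `ThetaEnvTower.Cor219_iii`},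
EVERY `p`** (abc-iut-f-153's `cor219_ii_modelTate_inr_of_rigidity` at `L∅` with `h218i :=` the levels theorem above).
[cite: MochizukiEtTh2009, Cor 2.19 (ii) p.64] -/
theorem cor219_ii_modelTate_inr_of_extends_of_parity
    (hextPar : ∀ γ : ↥C.Huu ≃ₜ* ↥C.Huu, ∃ Γ : PiTpχq p 1 2 ≃ₜ* PiTpχq p 1 2,
      (∀ h : C.Huu, Γ (h : PiTpχq p 1 2) = ((γ h : C.Huu) : PiTpχq p 1 2)) ∧
        (curveχq p 1 2).DeltaTemp.map Γ.toMulEquiv.toMonoidHom = (curveχq p 1 2).DeltaTemp ∧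
        (levelHom 2 (Γ (SemidirectProduct.inl (gfpOf (FreeGroup.of 0)))).left).y = 0)
    (h219iii : (C.thetaEnvTower τ (compat_modelχq p 1 2 even_two)
      (ThetaSetting.modelχq_sec2Hyps p 1 2 even_two)).Cor219_iii) :
    (C.thetaEnvTower τ (compat_modelχq p 1 2 even_two)
      (ThetaSetting.modelχq_sec2Hyps p 1 2 even_two)).Cor219_ii :=
  cor219_ii_modelTate_inr_of_rigidity p C τ _
    (cor218_i_levels_emptyLabels_modelTate_inr_of_extends_of_parity p C τ hextPar) h219iii

/-- **F-0647 [EtTh] Cor. 2.18 (iv) odd bijectivity for the model tower of the datum OF RECORD, modulo {`hextPar`,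
`ThetaEnvTower.Cor219_iii`}, EVERY `p`.** [cite: MochizukiEtTh2009, Cor 2.18 (iv) p.62] -/
theorem cor218_iv_bijective_of_odd_modelTate_inr_of_extends_of_parity
    (hextPar : ∀ γ : ↥C.Huu ≃ₜ* ↥C.Huu, ∃ Γ : PiTpχq p 1 2 ≃ₜ* PiTpχq p 1 2,
      (∀ h : C.Huu, Γ (h : PiTpχq p 1 2) = ((γ h : C.Huu) : PiTpχq p 1 2)) ∧
        (curveχq p 1 2).DeltaTemp.map Γ.toMulEquiv.toMonoidHom = (curveχq p 1 2).DeltaTemp ∧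
        (levelHom 2 (Γ (SemidirectProduct.inl (gfpOf (FreeGroup.of 0)))).left).y = 0)
    (h219iii : (C.thetaEnvTower τ (compat_modelχq p 1 2 even_two)
      (ThetaSetting.modelχq_sec2Hyps p 1 2 even_two)).Cor219_iii) :
    (C.thetaEnvTower τ (compat_modelχq p 1 2 even_two)
      (ThetaSetting.modelχq_sec2Hyps p 1 2 even_two)).Cor218_iv_bijective_of_odd :=
  cor218_iv_bijective_of_odd_modelTate_inr_of_rigidity p C τ _
    (cor218_i_levels_emptyLabels_modelTate_inr_of_extends_of_parity p C τ hextPar) h219iii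

/-- **F-0625 [EtTh] Cor. 2.18 (iv) surjectivity at EVERY level `M ∈ ℕ≥1` for the rigidity data of the datum OF RECORD (empty
labelling), modulo {`hextPar`, `ThetaEnvTower.Cor219_iii`}, EVERY `p`.** [cite: MochizukiEtTh2009, Cor 2.18 (iv) p.61] -/
theorem rigidData_cor218_iv_surjective_modAll_modelTate_inr_of_extends_of_parity (M : ℕ+)
    (hextPar : ∀ γ : ↥C.Huu ≃ₜ* ↥C.Huu, ∃ Γ : PiTpχq p 1 2 ≃ₜ* PiTpχq p 1 2,
      (∀ h : C.Huu, Γ (h : PiTpχq p 1 2) = ((γ h : C.Huu) : PiTpχq p 1 2)) ∧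
        (curveχq p 1 2).DeltaTemp.map Γ.toMulEquiv.toMonoidHom = (curveχq p 1 2).DeltaTemp ∧
        (levelHom 2 (Γ (SemidirectProduct.inl (gfpOf (FreeGroup.of 0)))).left).y = 0)
    (h219iii : (C.thetaEnvTower τ (compat_modelχq p 1 2 even_two)
      (ThetaSetting.modelχq_sec2Hyps p 1 2 even_two)).Cor219_iii) :
    (C.rigidData (τ.modAll M) (compat_modelχq p 1 2 even_two) (ThetaSetting.modelχq_sec2Hyps p 1 2 even_two)
      (prop15iii_etaleThetaDataχqInr p _) ⟨fun _ => ∅, fun _ => ∅, fun _ => rfl⟩).Cor218_iv_surjective :=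
  rigidData_cor218_iv_surjective_modAll_modelTate_inr_of_rigidity p C τ M _
    (cor218_i_levels_emptyLabels_modelTate_inr_of_extends_of_parity p C τ hextPar) h219iii

/-- **F-0639 the same in `ThetaEnvData` currency** (the input `hsurj` of the [IUTchII] Prop. 1.5 model bridges of layer L6),
modulo {`hextPar`, `ThetaEnvTower.Cor219_iii`}, EVERY `p`. [cite: MochizukiEtTh2009, Cor 2.18 (iv) p.61] -/
theorem thetaEnvData_cor218_iv_surjective_modAll_modelTate_inr_of_extends_of_parity (M : ℕ+)
    (hextPar : ∀ γ : ↥C.Huu ≃ₜ* ↥C.Huu, ∃ Γ : PiTpχq p 1 2 ≃ₜ* PiTpχq p 1 2,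
      (∀ h : C.Huu, Γ (h : PiTpχq p 1 2) = ((γ h : C.Huu) : PiTpχq p 1 2)) ∧
        (curveχq p 1 2).DeltaTemp.map Γ.toMulEquiv.toMonoidHom = (curveχq p 1 2).DeltaTemp ∧
        (levelHom 2 (Γ (SemidirectProduct.inl (gfpOf (FreeGroup.of 0)))).left).y = 0)
    (h219iii : (C.thetaEnvTower τ (compat_modelχq p 1 2 even_two)
      (ThetaSetting.modelχq_sec2Hyps p 1 2 even_two)).Cor219_iii) :
    (C.thetaEnvData (τ.modAll M) (compat_modelχq p 1 2 even_two)
      (ThetaSetting.modelχq_sec2Hyps p 1 2 even_two)).Cor218_iv_surjective :=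
  thetaEnvData_cor218_iv_surjective_modAll_modelTate_inr_of_rigidity p C τ M _
    (cor218_i_levels_emptyLabels_modelTate_inr_of_extends_of_parity p C τ hextPar) h219iii

/-- **THE §2 TOWER ROWS AT THE DATUM OF RECORD, modulo {`hextPar`, `ThetaEnvTower.Cor219_iii`}, EVERY `p`**: Cor. 2.16
(F-0646) ∧ Cor. 2.18 (iv) reduction (F-0648) ∧ Cor. 2.18 (iv) odd bijectivity (F-0647) ∧ Cor. 2.19 (ii) (F-0649) —
abc-iut-f-153's `sec2_tower_rows_modelTate_inr_of_rigidity` with the Cor. 2.18 (i) binder in its parity-explicit,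
(HGAL)-free form. [cite: MochizukiEtTh2009, Cor 2.19 (ii) p.64] -/
theorem sec2_tower_rows_modelTate_inr_of_extends_of_parity
    (hextPar : ∀ γ : ↥C.Huu ≃ₜ* ↥C.Huu, ∃ Γ : PiTpχq p 1 2 ≃ₜ* PiTpχq p 1 2,
      (∀ h : C.Huu, Γ (h : PiTpχq p 1 2) = ((γ h : C.Huu) : PiTpχq p 1 2)) ∧
        (curveχq p 1 2).DeltaTemp.map Γ.toMulEquiv.toMonoidHom = (curveχq p 1 2).DeltaTemp ∧
        (levelHom 2 (Γ (SemidirectProduct.inl (gfpOf (FreeGroup.of 0)))).left).y = 0)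
    (h219iii : (C.thetaEnvTower τ (compat_modelχq p 1 2 even_two)
      (ThetaSetting.modelχq_sec2Hyps p 1 2 even_two)).Cor219_iii) :
    (C.thetaEnvTower τ (compat_modelχq p 1 2 even_two) (ThetaSetting.modelχq_sec2Hyps p 1 2 even_two)).Cor216 ∧
    (C.thetaEnvTower τ (compat_modelχq p 1 2 even_two)
      (ThetaSetting.modelχq_sec2Hyps p 1 2 even_two)).Cor218_iv_reduction ∧
    (C.thetaEnvTower τ (compat_modelχq p 1 2 even_two)
      (ThetaSetting.modelχq_sec2Hyps p 1 2 even_two)).Cor218_iv_bijective_of_odd ∧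
    (C.thetaEnvTower τ (compat_modelχq p 1 2 even_two)
      (ThetaSetting.modelχq_sec2Hyps p 1 2 even_two)).Cor219_ii :=
  sec2_tower_rows_modelTate_inr_of_rigidity p C τ _
    (cor218_i_levels_emptyLabels_modelTate_inr_of_extends_of_parity p C τ hextPar) h219iii

end SettingModel

end Literature.AnabelianGeometry.EtaleTheta

end
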